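import Literature.MathematicalPhysics.QuantumFieldTheory.BalabanImbrieJaffe1984to88.BIJ88Extraction311

/-!
# `BalabanImbrieJaffe1984to88.BIJ88Extraction311Bound` — T. Bałaban, J. Imbrie, A. Jaffe, *Effective action and cluster properties of the
abelian Higgs model*, Commun. Math. Phys. **114** (1988) 257–315 [BalabanImbrieJaffe1988]: Sect. 5.14, pp. 310–311 [PDF 54–55] — THE SOURCE
MAJORANTS of `W₆^{(k)″}(X)`: for the `W₆″ = W6pp` DEFINED in `BIJ88Extraction311` (F-B1 of this seat: the named sum of its three printed sources) the
elementary bounds of each source from per-term bounds in the printed shapes — *"The others, localized in region X, have a factor of e^{−cr(e_k)|X|}"*,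
*"terms localized near Λ₁₂^{(k)c} … bounded by a small power of coupling constants"*, *"each vertex results in at least a factor e^β(L^kε/ε₀)^{1/4−α}"* —
and the REASON for the two cases of the p. 311 bound made explicit (the boundary sources live near `Λ₁₂^c` only); the sequel
`BIJ88Extraction311TwoCase` turns them into r16's leaf `BIJ88Sect5StatementsPart2.IneqW6` for `W₆ = W₆′ + W₆″`

statement-level skeleton of published theorems with citation tags; proofs where landed; nothing here is a claim about the Yang–Mills mass gap

PDF held: `paper:balaban1988-cmp114-bij-abelian-higgs-effective-action` (journal page = PDF page + 256); pp. 310–311 [PDF 54–55] read this session as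
images (`HOME/lit-balaban-p31/renders/original-p054/p055-x2.png`).

CITATION HEADER (verbatim).  p. 310 [PDF 54]: *"The leading terms, with only propagators C^{(k)}_{Λ₁₂^{(k)},loc}, C^{(k)}_{Λ₁₂^{(k)},loc}(u_{k+1}), we
transform further. The others, localized in region X, have a factor of e^{−cr(e_k)|X|}. We also consider as remainders any terms whose order in λ
and e is greater than n̄. … The replacement of C^{(k)}_{Λ₁₂^{(k)},loc} with C^{(k)}_{ℤ^d,loc} produces"* p. 311 [PDF 55]: *"terms localized near
Λ₁₂^{(k)c}. These terms are bounded by a small power of coupling constants, e^β(L^kε/ε₀)^{1/4−α}. … we extend the localizations of vertices in all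
diagrams back to Λ̄₈^{(k)}. This produces more boundary terms … If we put W₆^{(k)}(X) = W₆^{(k)′}(X) + W₆^{(k)″}(X), then W₆^{(k)}(X) obeys
|W₆^{(k)}(X)| ≤ (e^β(L^kε/ε₀)^{1/4−α})^{n̄+1+β′|X|}, dist(X, Λ₁₂^{(k),c}) ≥ r(e_k); (e^β(L^kε/ε₀)^{1/4−α})^{β′|X|}, otherwise."*; p. 298 [PDF 42]:
*"each vertex results in at least a factor e^β(L^kε/ε₀)^{1/4−α}"*; (2.46) p. 264 [PDF 8]: *"|C^{(k)}_{Λ,X}(u; x₁, x₂)| ≦ e^{−cr(e_k)|X|}"*.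

WHAT IS REPRODUCED.  SKELETON row **C2.Claim@310** of `HOME/lit-balaban-r16/ROWS-C2-part2.md` (head typed; typed leaf `BIJ88Sect5StatementsPart2.IneqW6`,
r16 p240155; member `BIJ88ScalarComposition311` p319635 at v2.92); companion of this seat's `BIJ88Extraction311` (F-B1, p319972).  Cell `lit-balaban`,
HOME `run/shared/lean/pub/lit-balaban/`; Phase-2 seat p31 gen 12 = unit `lit-balaban-p31-g12`; TAKING line HOME/STATUS.md 2026-08-22T05:17:14Z; owner
r16, referee ref-5.  W₆-LEAVES FED BY NAME: none here directly — the sequel `BIJ88Extraction311TwoCase.ineqW6_of_extraction` concludes `IneqW6` from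
these majorants and the leaf `IneqW6′`.

WHAT IS PROVED (theorems only; 0 `sorry`; 0 defs / 0 `Prop` facts; imports F-B1 only).  Data of `BIJ88Extraction311`: diagram shapes `γ : D` with
`m γ ≤ M` propagator slots and coupling order `ord γ ≥ 1`, pieces `pc s` of the propagator of species `s` with regions `reg r`, `W6pp A W′ X` = (i) the
terms with a piece, localized at `X` + (ii) the leading terms of order `> n̄` at `{x}`, `x ∈ W′ = Λ₁₂` − (iii) the re-localized leading terms at `{x}`,
`x ∈ A ∖ W′ = Λ̄₈ ∖ Λ₁₂`; θ = the vertex factor `e^β(L^kε/ε₀)^{1/4−α} ∈ [0,1]`; `far X` = *"dist(X, Λ₁₂^{(k),c}) ≥ r(e_k)"* (a predicate; `far X → X ⊆ W′`);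
`cr = c·r(e_k) ≥ 0`.  PRINTED-SHAPE SOURCE BOUNDS (displayed hypotheses): (T) *"each vertex results in at least a factor θ"* times the sizes of the
pieces used — `|term γ x a| ≤ θ^{ord γ}·Π_i size(a i)`, `size(none) = 1`, `size(some r) = ε r ≥ 0`; (RW) interior pieces *"localized in region X, have a
factor of e^{−cr(e_k)|X|}"* — `ε r ≤ e^{−cr·|reg r|}`, `reg r ≠ ∅`; (B) boundary pieces *"localized near Λ₁₂^c … bounded by a small power of coupling
constants"* — `ε r ≤ 1`, `|reg r| ≤ b₀`, `reg r ⊆ X → ¬ far X`; (N) multiplicity — at most `q^{|X|} − 1` pieces of a species with region inside `X`.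
  `card_filter_loc_le` (≤ `q^{M|X|}` non-leading slot fillings localized at `X`), `card_le_of_loc_eq` (`|X| ≤ 1 + Σ_i |reg(a i)|`), `prod_size_le_exp`
  (Π size ≤ `(e^{−cr})^{Σ_interior |reg|}`), `prod_size_le_exp_far` (far `X`, non-leading filling: `≤ (e^{−cr/2})^{|X|}` — no boundary piece occurs),
  `prod_size_le_exp_near` (any `X`: `≤ (e^{−cr})^{|X| − b₁}`, `b₁ = 1 + M b₀`, truncated subtraction), `abs_std_le`, `abs_term_le_theta`, `abs_piecePart_le`
  (source (i) ≤ `|X|·|D|·q^{M|X|}·θ·B` from a uniform filling bound `θB`), **`abs_piecePart_le_far`** (far: ≤ `|X|·|D|·q^{M|X|}·θ·(e^{−cr/2})^{|X|}`),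
  **`abs_piecePart_le_near`** (≤ `|X|·|D|·q^{M|X|}·θ·(e^{−cr})^{|X|−b₁}`), **`abs_highPart_le`** (source (ii) ≤ `|D|θ^{n̄+1}`), `highPart_eq_zero_of_card_ne_one`,
  **`abs_relocPart_le`** (source (iii) ≤ `|D|θ`), `relocPart_eq_zero_of_card_ne_one`, **`relocPart_eq_zero_of_far`** (WHY TWO CASES: source (iii) is
  anchored in `Λ̄₈ ∖ Λ₁₂`, never at a far `X`; and at a far `X` no boundary piece enters source (i)).
HONEST SCOPE.  (T)/(RW)/(B)/(N) are the printed sentences as DISPLAYED HYPOTHESES on the bookkeeping data of `BIJ88Extraction311` (the paper's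
*"standard exercise"*: (RW) is (2.46), row C2.Eq2.46, for the random-walk pieces; (T) the p. 298 vertex-factor rule; (B) the p. 311 sentence; (N) the
finiteness of the localization expansions), not derived from Sects. 2–4; the READING of `BIJ88Extraction311` (each diagram term anchored at one vertex
cube, `W₆″(X)` collected by localization region) is inherited.  Nothing on (5.14.4) or on `W₆′`.  NOT summit progress.
-/

namespace Literature.MathematicalPhysics.QuantumFieldTheory.BalabanImbrieJaffe1984to88.BIJ88Extraction311Bound

open Finset
open Literature.MathematicalPhysics.QuantumFieldTheory.BalabanImbrieJaffe1984to88.BIJ88Sect5StatementsPart2 (IneqW6 IneqW6')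
open Literature.MathematicalPhysics.QuantumFieldTheory.BalabanImbrieJaffe1984to88.BIJ88Ineq5113Covering (cubeSys cubeSys_card)
open Literature.MathematicalPhysics.QuantumFieldTheory.BalabanImbrieJaffe1984to88.BIJ88Extraction311 (choices term std loc W6pp
  none_mem_choices term_none mem_loc reg_subset_loc)

noncomputable section

variable {ι : Type} [DecidableEq ι]
variable {S : Type*} {K : Type*} [AddCommGroup K] [Module ℝ K]
variable {D : Type*} [Fintype D] {P : Type*} [DecidableEq P]
variable (m : D → ℕ) (spec : (γ : D) → Fin (m γ) → S) (T : (γ : D) → ι → MultilinearMap ℝ (fun _ : Fin (m γ) => K) ℝ)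
variable (Cstd : S → K) (pc : S → Finset P) (E : S → P → K) (reg : P → Finset ι) (ord : D → ℕ) (nbar : ℕ)

/-! ## §1 The three sources of `W₆″(X)` and their elementary majorants -/

/-! ### Counting the slot fillings localized at `X` (hypothesis (N)) -/

omit [Fintype D] in
/-- **Multiplicity.** If every species has at most `q^{|X|} − 1` pieces with region inside `X` (hypothesis (N), `q ≥ 1`) and a diagram has `m γ ≤ M`
slots, then at most `q^{M|X|}` of its non-leading slot fillings are localized at `X` (each slot carries the standard covariance or a piece with region
`⊆ X`). [cite: BalabanImbrieJaffe1988, p.310 (Sect. 5.14)] -/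
theorem card_filter_loc_le {q M : ℕ} (hq : 1 ≤ q) (hN : ∀ s X, ((pc s).filter (fun r => reg r ⊆ X)).card + 1 ≤ q ^ X.card)
    {γ : D} (hM : m γ ≤ M) (x : ι) (X : Finset ι) :
    (((choices m spec pc γ).erase (fun _ => none)).filter (fun a => loc m reg γ x a = X)).card ≤ q ^ (M * X.card) := by
  have hsub : ((choices m spec pc γ).erase (fun _ => none)).filter (fun a => loc m reg γ x a = X)
      ⊆ Fintype.piFinset fun i => insertNone ((pc (spec γ i)).filter fun r => reg r ⊆ X) := by
    intro a ha
    rw [mem_filter] at ha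
    obtain ⟨ha, hloc⟩ := ha
    have hch := Fintype.mem_piFinset.1 (mem_of_mem_erase ha)
    refine Fintype.mem_piFinset.2 fun i => mem_insertNone.2 fun r hr => mem_filter.2 ⟨mem_insertNone.1 (hch i) r hr, ?_⟩
    rw [← hloc]
    exact reg_subset_loc m reg γ x a (Option.mem_def.1 hr)
  refine (card_le_card hsub).trans ?_
  rw [Fintype.card_piFinset]
  calc ∏ i, (insertNone ((pc (spec γ i)).filter fun r => reg r ⊆ X)).card
      ≤ ∏ _i : Fin (m γ), q ^ X.card :=
        prod_le_prod (fun i _ => Nat.zero_le _) fun i _ => by rw [card_insertNone]; exact hN _ _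
    _ = q ^ (m γ * X.card) := by rw [prod_const, card_univ, Fintype.card_fin, ← pow_mul, Nat.mul_comm]
    _ ≤ q ^ (M * X.card) := Nat.pow_le_pow_right (by omega) (Nat.mul_le_mul_right _ hM)

/-! ### The localization region controls the total size of the pieces used -/

omit [Fintype D] [DecidableEq P] in
/-- `|X| ≤ 1 + Σ_i |reg(a i)|` for a filling localized at `X = {x} ∪ ⋃_i reg(a i)` (leading slots contribute `0`).
[cite: BalabanImbrieJaffe1988, p.310 (Sect. 5.14)] -/
theorem card_le_of_loc_eq {γ : D} {x : ι} {a : Fin (m γ) → Option P} {X : Finset ι} (hloc : loc m reg γ x a = X) :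
    X.card ≤ 1 + ∑ i, ((a i).elim 0 fun r => (reg r).card) := by
  rw [← hloc, loc, add_comm]
  refine (card_insert_le _ _).trans (Nat.add_le_add_right (card_biUnion_le.trans (sum_le_sum fun i _ => ?_)) 1)
  cases a i <;> simp

omit [DecidableEq ι] [DecidableEq P] in
/-- kernel of (RW)/(B): the product of the slot sizes is at most `(e^{−cr})^{Σ_{interior slots} |reg|}` when interior pieces carry `e^{−cr|reg|}`,
boundary pieces carry `≤ 1`, and all sizes are `≥ 0`. [cite: BalabanImbrieJaffe1988, p.310 (Sect. 5.14)] -/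
theorem prod_size_le_exp {ε : P → ℝ} {bd : P → Prop} [DecidablePred bd] {cr : ℝ} (hε0 : ∀ r, 0 ≤ ε r)
    (hint : ∀ r, ¬ bd r → ε r ≤ Real.exp (-cr * (reg r).card)) (hbd : ∀ r, bd r → ε r ≤ 1) {n : ℕ} (a : Fin n → Option P) :
    ∏ i, ((a i).elim (1 : ℝ) ε) ≤ Real.exp (-cr) ^ (∑ i, ((a i).elim 0 fun r => if bd r then 0 else (reg r).card)) := by
  rw [← prod_pow_eq_pow_sum]
  refine prod_le_prod (fun i _ => ?_) (fun i _ => ?_)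
  · cases a i with
    | none => exact zero_le_one
    | some r => exact hε0 r
  · cases a i with
    | none => simp
    | some r =>
      by_cases hr : bd r
      · simpa [hr] using hbd r hr
      · have h := hint r hr
        rw [mul_comm, Real.exp_nat_mul] at h
        simpa [hr] using h

omit [Fintype D] [DecidableEq P] in
/-- **Far from `Λ₁₂^c`: `Π size ≤ (e^{−cr/2})^{|X|}`** for a NON-LEADING filling localized at a far `X`: by (B) no boundary piece occurs (they live
near `Λ₁₂^c`), so all pieces are interior, `Σ|reg| ≥ max(1, |X| − 1) ≥ |X|/2`. [cite: BalabanImbrieJaffe1988, p.310 (Sect. 5.14)] -/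
theorem prod_size_le_exp_far {ε : P → ℝ} {bd : P → Prop} [DecidablePred bd] {cr : ℝ} (hcr : 0 ≤ cr) (hε0 : ∀ r, 0 ≤ ε r)
    (hint : ∀ r, ¬ bd r → ε r ≤ Real.exp (-cr * (reg r).card) ∧ (reg r).Nonempty) (hbd : ∀ r, bd r → ε r ≤ 1)
    {far : Finset ι → Prop} (hfarB : ∀ r, bd r → ∀ X, reg r ⊆ X → ¬ far X)
    {γ : D} {x : ι} {a : Fin (m γ) → Option P} {X : Finset ι} (ha : a ≠ fun _ => none) (hloc : loc m reg γ x a = X) (hX : far X) :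
    ∏ i, ((a i).elim (1 : ℝ) ε) ≤ Real.exp (-(cr / 2)) ^ X.card := by
  have hnobd : ∀ i r, a i = some r → ¬ bd r := fun i r hi hr => hfarB r hr X (hloc ▸ reg_subset_loc m reg γ x a hi) hX
  refine (prod_size_le_exp reg hε0 (fun r hr => (hint r hr).1) hbd a).trans ?_
  have hNeq : ∑ i, ((a i).elim 0 fun r => if bd r then 0 else (reg r).card) = ∑ i, ((a i).elim 0 fun r => (reg r).card) := by
    refine sum_congr rfl fun i _ => ?_
    rcases hai : a i with _ | r
    · rfl
    · simp [hnobd i r hai]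
  have h1 : X.card ≤ 1 + ∑ i, ((a i).elim 0 fun r => (reg r).card) := card_le_of_loc_eq m reg hloc
  obtain ⟨i₀, hi₀⟩ : ∃ i, a i ≠ none := by
    by_contra h
    push Not at h
    exact ha (funext h)
  obtain ⟨r₀, hr₀⟩ := Option.ne_none_iff_exists'.1 hi₀
  have h2 : 1 ≤ ∑ i, ((a i).elim 0 fun r => (reg r).card) := by
    refine le_trans ?_ (single_le_sum (f := fun i => (a i).elim 0 fun r => (reg r).card) (fun i _ => Nat.zero_le _) (mem_univ i₀))
    have hpos := (hint r₀ (hnobd i₀ r₀ hr₀)).2.card_pos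
    simp only [hr₀, Option.elim_some]
    omega
  have h3 : X.card ≤ 2 * ∑ i, ((a i).elim 0 fun r => if bd r then 0 else (reg r).card) := by rw [hNeq]; omega
  have he1 : Real.exp (-(cr / 2)) ≤ 1 := Real.exp_le_one_iff.2 (by linarith)
  have hsq : Real.exp (-cr) = Real.exp (-(cr / 2)) ^ 2 := by rw [sq, ← Real.exp_add]; congr 1; ring
  rw [hsq, ← pow_mul]
  exact pow_le_pow_of_le_one (Real.exp_nonneg _) he1 h3

omit [Fintype D] [DecidableEq P] in
/-- **In general (near `Λ₁₂^c` allowed): `Π size ≤ (e^{−cr})^{|X| − b₁}`, `b₁ = 1 + M·b₀`** (truncated subtraction) — the boundary pieces (at most `M`,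
regions of at most `b₀` cubes each) carry no decay, the interior ones do. [cite: BalabanImbrieJaffe1988, p.311 (Sect. 5.14)] -/
theorem prod_size_le_exp_near {ε : P → ℝ} {bd : P → Prop} [DecidablePred bd] {cr : ℝ} (hcr : 0 ≤ cr) (hε0 : ∀ r, 0 ≤ ε r)
    (hint : ∀ r, ¬ bd r → ε r ≤ Real.exp (-cr * (reg r).card)) {b₀ : ℕ} (hbd : ∀ r, bd r → ε r ≤ 1 ∧ (reg r).card ≤ b₀)
    {M : ℕ} {γ : D} (hM : m γ ≤ M) {x : ι} {a : Fin (m γ) → Option P} {X : Finset ι} (hloc : loc m reg γ x a = X) :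
    ∏ i, ((a i).elim (1 : ℝ) ε) ≤ Real.exp (-cr) ^ (X.card - (1 + M * b₀)) := by
  refine (prod_size_le_exp reg hε0 hint (fun r hr => (hbd r hr).1) a).trans ?_
  have h1 : X.card ≤ 1 + ∑ i, ((a i).elim 0 fun r => (reg r).card) := card_le_of_loc_eq m reg hloc
  have h2 : ∀ i, ((a i).elim 0 fun r => (reg r).card) ≤ ((a i).elim 0 fun r => if bd r then 0 else (reg r).card) + b₀ := by
    intro i
    rcases a i with _ | r
    · simp
    · by_cases hr : bd r
      · simpa [hr] using (hbd r hr).2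
      · simp [hr]
  have h3 : ∑ i, ((a i).elim 0 fun r => (reg r).card) ≤ (∑ i, ((a i).elim 0 fun r => if bd r then 0 else (reg r).card)) + m γ * b₀ := by
    refine (sum_le_sum fun i _ => h2 i).trans ?_
    rw [sum_add_distrib, sum_const, card_univ, Fintype.card_fin, smul_eq_mul]
  have h4 : m γ * b₀ ≤ M * b₀ := Nat.mul_le_mul_right _ hM
  have h5 : X.card - (1 + M * b₀) ≤ ∑ i, ((a i).elim 0 fun r => if bd r then 0 else (reg r).card) := by omega
  exact pow_le_pow_of_le_one (Real.exp_nonneg _) (Real.exp_le_one_iff.2 (by linarith)) h5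

/-! ### Source (i): the terms with a piece, localized at `X` -/

omit [DecidableEq ι] [Fintype D] [DecidableEq P] in
/-- (T) at the leading filling: `|std γ x| ≤ θ^{ord γ}`. [cite: BalabanImbrieJaffe1988, p.298 (Sect. 5.10)] -/
theorem abs_std_le {θ : ℝ} {ε : P → ℝ}
    (hT : ∀ γ x a, a ∈ choices m spec pc γ → |term m spec T Cstd E γ x a| ≤ θ ^ ord γ * ∏ i, ((a i).elim (1 : ℝ) ε)) (γ : D) (x : ι) :
    |std m spec T Cstd γ x| ≤ θ ^ ord γ := by
  simpa [term_none] using hT γ x (fun _ => none) (none_mem_choices m spec pc γ)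

omit [DecidableEq ι] [Fintype D] [DecidableEq P] in
/-- (T) with `0 ≤ θ ≤ 1`, `ord ≥ 1`: every filling has `|term| ≤ θ·Π size` (*"each vertex results in at least a factor"* θ).
[cite: BalabanImbrieJaffe1988, p.298 (Sect. 5.10)] -/
theorem abs_term_le_theta {θ : ℝ} (hθ0 : 0 ≤ θ) (hθ1 : θ ≤ 1) {ε : P → ℝ} (hε0 : ∀ r, 0 ≤ ε r) (hord : ∀ γ, 1 ≤ ord γ)
    (hT : ∀ γ x a, a ∈ choices m spec pc γ → |term m spec T Cstd E γ x a| ≤ θ ^ ord γ * ∏ i, ((a i).elim (1 : ℝ) ε))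
    {γ : D} {x : ι} {a : Fin (m γ) → Option P} (ha : a ∈ choices m spec pc γ) :
    |term m spec T Cstd E γ x a| ≤ θ * ∏ i, ((a i).elim (1 : ℝ) ε) := by
  refine (hT γ x a ha).trans (mul_le_mul_of_nonneg_right ?_ (prod_nonneg fun i _ => ?_))
  · calc θ ^ ord γ ≤ θ ^ 1 := pow_le_pow_of_le_one hθ0 hθ1 (hord γ)
      _ = θ := pow_one θ
  · cases a i with
    | none => exact zero_le_one
    | some r => exact hε0 r

omit [Fintype D] in
/-- fillings localized at `X` have their vertex cube in `X`: for `x ∉ X` there are none. [cite: BalabanImbrieJaffe1988, p.310 (Sect. 5.14)] -/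
theorem filter_loc_eq_empty_of_not_mem {γ : D} {x : ι} {X : Finset ι} (hx : x ∉ X) :
    ((choices m spec pc γ).erase (fun _ => none)).filter (fun a => loc m reg γ x a = X) = ∅ :=
  filter_eq_empty_iff.2 fun a _ h => hx (h ▸ mem_loc m reg γ x a)

/-- **Source (i), generic majorant**: if every non-leading filling localized at `X` has `|term| ≤ θ·B` (`θ, B ≥ 0`), then by (N)
`|Σ_{x∈W′} Σ_γ Σ_{a : loc = X} term| ≤ |X|·|D|·q^{M|X|}·θ·B` (only vertex cubes `x ∈ X` contribute). [cite: BalabanImbrieJaffe1988, p.310 (Sect. 5.14)] -/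
theorem abs_piecePart_le {q M : ℕ} (hq : 1 ≤ q) (hN : ∀ s X, ((pc s).filter (fun r => reg r ⊆ X)).card + 1 ≤ q ^ X.card)
    (hM : ∀ γ, m γ ≤ M) {θ B : ℝ} (hθ0 : 0 ≤ θ) (hB : 0 ≤ B) (W' X : Finset ι)
    (hterm : ∀ γ, ∀ x ∈ W', ∀ a ∈ ((choices m spec pc γ).erase (fun _ => none)).filter (fun a => loc m reg γ x a = X),
      |term m spec T Cstd E γ x a| ≤ θ * B) :
    |∑ x ∈ W', ∑ γ, ∑ a ∈ ((choices m spec pc γ).erase (fun _ => none)).filter (fun a => loc m reg γ x a = X),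
        term m spec T Cstd E γ x a|
      ≤ X.card * Fintype.card D * (q : ℝ) ^ (M * X.card) * θ * B := by
  have hp : ∀ x ∈ W', (∑ γ, ∑ a ∈ ((choices m spec pc γ).erase (fun _ => none)).filter (fun a => loc m reg γ x a = X),
      term m spec T Cstd E γ x a) ≠ 0 → x ∈ X := by
    intro x _ hne
    by_contra hx
    exact hne (sum_eq_zero fun γ _ => by rw [filter_loc_eq_empty_of_not_mem m spec pc reg hx, sum_empty])
  rw [← sum_filter_of_ne hp]
  refine (abs_sum_le_sum_abs _ _).trans ?_
  have hnn : 0 ≤ Fintype.card D * (q : ℝ) ^ (M * X.card) * θ * B := by positivity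
  have hx1 : ∀ x ∈ W'.filter (fun x => x ∈ X), |∑ γ, ∑ a ∈ ((choices m spec pc γ).erase (fun _ => none)).filter
      (fun a => loc m reg γ x a = X), term m spec T Cstd E γ x a| ≤ Fintype.card D * (q : ℝ) ^ (M * X.card) * θ * B := by
    intro x hx
    have hxW : x ∈ W' := (mem_filter.1 hx).1
    refine (abs_sum_le_sum_abs _ _).trans ?_
    have hγ : ∀ γ ∈ (univ : Finset D), |∑ a ∈ ((choices m spec pc γ).erase (fun _ => none)).filter
        (fun a => loc m reg γ x a = X), term m spec T Cstd E γ x a| ≤ (q : ℝ) ^ (M * X.card) * θ * B := by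
      intro γ _
      refine (abs_sum_le_sum_abs _ _).trans ((sum_le_sum fun a ha => hterm γ x hxW a ha).trans ?_)
      rw [sum_const, nsmul_eq_mul]
      have hc : ((((choices m spec pc γ).erase (fun _ => none)).filter (fun a => loc m reg γ x a = X)).card : ℝ)
          ≤ (q : ℝ) ^ (M * X.card) := by
        exact_mod_cast card_filter_loc_le m spec pc reg hq hN (hM γ) x X
      exact (mul_le_mul_of_nonneg_right hc (mul_nonneg hθ0 hB)).trans_eq (by ring)
    refine (sum_le_sum hγ).trans ?_
    rw [sum_const, card_univ, nsmul_eq_mul]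
    exact le_of_eq (by ring)
  refine (sum_le_sum hx1).trans ?_
  rw [sum_const, nsmul_eq_mul]
  have hcard : ((W'.filter fun x => x ∈ X).card : ℝ) ≤ X.card := by
    exact_mod_cast card_le_card fun x hx => (mem_filter.1 hx).2
  calc _ ≤ (X.card : ℝ) * (Fintype.card D * (q : ℝ) ^ (M * X.card) * θ * B) := mul_le_mul_of_nonneg_right hcard hnn
    _ = _ := by ring

/-- **Source (i) at a far `X`**: `|piece part(X)| ≤ |X|·|D|·q^{M|X|}·θ·(e^{−cr/2})^{|X|}` — from (T), (RW), (B) (no boundary piece occurs far from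
`Λ₁₂^c`) and (N). [cite: BalabanImbrieJaffe1988, p.310 (Sect. 5.14)] -/
theorem abs_piecePart_le_far {q M : ℕ} (hq : 1 ≤ q) (hN : ∀ s X, ((pc s).filter (fun r => reg r ⊆ X)).card + 1 ≤ q ^ X.card)
    (hM : ∀ γ, m γ ≤ M) {θ : ℝ} (hθ0 : 0 ≤ θ) (hθ1 : θ ≤ 1) (hord : ∀ γ, 1 ≤ ord γ)
    {ε : P → ℝ} {bd : P → Prop} [DecidablePred bd] {cr : ℝ} (hcr : 0 ≤ cr) (hε0 : ∀ r, 0 ≤ ε r)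
    (hint : ∀ r, ¬ bd r → ε r ≤ Real.exp (-cr * (reg r).card) ∧ (reg r).Nonempty) (hbd : ∀ r, bd r → ε r ≤ 1)
    {far : Finset ι → Prop} (hfarB : ∀ r, bd r → ∀ X, reg r ⊆ X → ¬ far X)
    (hT : ∀ γ x a, a ∈ choices m spec pc γ → |term m spec T Cstd E γ x a| ≤ θ ^ ord γ * ∏ i, ((a i).elim (1 : ℝ) ε))
    (W' : Finset ι) {X : Finset ι} (hX : far X) :
    |∑ x ∈ W', ∑ γ, ∑ a ∈ ((choices m spec pc γ).erase (fun _ => none)).filter (fun a => loc m reg γ x a = X),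
        term m spec T Cstd E γ x a|
      ≤ X.card * Fintype.card D * (q : ℝ) ^ (M * X.card) * θ * Real.exp (-(cr / 2)) ^ X.card := by
  refine abs_piecePart_le m spec T Cstd pc E reg hq hN hM hθ0 (pow_nonneg (Real.exp_nonneg _) _) W' X fun γ x _ a ha => ?_
  obtain ⟨ha', hloc⟩ := mem_filter.1 ha
  refine (abs_term_le_theta m spec T Cstd pc E ord hθ0 hθ1 hε0 hord hT (mem_of_mem_erase ha')).trans ?_
  exact mul_le_mul_of_nonneg_left (prod_size_le_exp_far m reg hcr hε0 hint hbd hfarB (ne_of_mem_erase ha') hloc hX) hθ0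

/-- **Source (i) at any `X`**: `|piece part(X)| ≤ |X|·|D|·q^{M|X|}·θ·(e^{−cr})^{|X| − b₁}`, `b₁ = 1 + Mb₀` — boundary pieces allowed.
[cite: BalabanImbrieJaffe1988, p.311 (Sect. 5.14)] -/
theorem abs_piecePart_le_near {q M b₀ : ℕ} (hq : 1 ≤ q) (hN : ∀ s X, ((pc s).filter (fun r => reg r ⊆ X)).card + 1 ≤ q ^ X.card)
    (hM : ∀ γ, m γ ≤ M) {θ : ℝ} (hθ0 : 0 ≤ θ) (hθ1 : θ ≤ 1) (hord : ∀ γ, 1 ≤ ord γ)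
    {ε : P → ℝ} {bd : P → Prop} [DecidablePred bd] {cr : ℝ} (hcr : 0 ≤ cr) (hε0 : ∀ r, 0 ≤ ε r)
    (hint : ∀ r, ¬ bd r → ε r ≤ Real.exp (-cr * (reg r).card)) (hbd : ∀ r, bd r → ε r ≤ 1 ∧ (reg r).card ≤ b₀)
    (hT : ∀ γ x a, a ∈ choices m spec pc γ → |term m spec T Cstd E γ x a| ≤ θ ^ ord γ * ∏ i, ((a i).elim (1 : ℝ) ε))
    (W' X : Finset ι) :
    |∑ x ∈ W', ∑ γ, ∑ a ∈ ((choices m spec pc γ).erase (fun _ => none)).filter (fun a => loc m reg γ x a = X),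
        term m spec T Cstd E γ x a|
      ≤ X.card * Fintype.card D * (q : ℝ) ^ (M * X.card) * θ * Real.exp (-cr) ^ (X.card - (1 + M * b₀)) := by
  refine abs_piecePart_le m spec T Cstd pc E reg hq hN hM hθ0 (pow_nonneg (Real.exp_nonneg _) _) W' X fun γ x _ a ha => ?_
  obtain ⟨ha', hloc⟩ := mem_filter.1 ha
  refine (abs_term_le_theta m spec T Cstd pc E ord hθ0 hθ1 hε0 hord hT (mem_of_mem_erase ha')).trans ?_
  exact mul_le_mul_of_nonneg_left (prod_size_le_exp_near m reg hcr hε0 hint hbd (hM γ) hloc) hθ0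

/-! ### Sources (ii) and (iii): the singleton-anchored leading terms -/

/-- kernel: at most one cube `x` has `{x} = X`. [folklore] -/
private theorem card_filter_singleton_le_one (s : Finset ι) (X : Finset ι) :
    (s.filter fun x => ({x} : Finset ι) = X).card ≤ 1 :=
  card_le_one.2 fun _ ha _ hb => singleton_injective ((mem_filter.1 ha).2.trans (mem_filter.1 hb).2.symm)

omit [DecidableEq P] in
/-- **Source (ii)**: the leading terms of order `> n̄` anchored at `X` (*"We also consider as remainders any terms whose order in λ and e is greater
than n̄"*): by (T) each is `≤ θ^{ord} ≤ θ^{n̄+1}`, and they are anchored at a single cube: `|high part(X)| ≤ |D|·θ^{n̄+1}`.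
[cite: BalabanImbrieJaffe1988, p.310 (Sect. 5.14)] -/
theorem abs_highPart_le {θ : ℝ} (hθ0 : 0 ≤ θ) (hθ1 : θ ≤ 1) (hstd : ∀ γ x, |std m spec T Cstd γ x| ≤ θ ^ ord γ) (W' X : Finset ι) :
    |∑ x ∈ W'.filter (fun x => ({x} : Finset ι) = X), ∑ γ ∈ univ.filter (fun γ => nbar < ord γ), std m spec T Cstd γ x|
      ≤ Fintype.card D * θ ^ (nbar + 1) := by
  refine (abs_sum_le_sum_abs _ _).trans ?_
  have hnn : 0 ≤ Fintype.card D * θ ^ (nbar + 1) := by positivity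
  have h1 : ∀ x ∈ W'.filter (fun x => ({x} : Finset ι) = X),
      |∑ γ ∈ univ.filter (fun γ => nbar < ord γ), std m spec T Cstd γ x| ≤ Fintype.card D * θ ^ (nbar + 1) := by
    intro x _
    refine (abs_sum_le_sum_abs _ _).trans ?_
    have h2 : ∀ γ ∈ univ.filter (fun γ => nbar < ord γ), |std m spec T Cstd γ x| ≤ θ ^ (nbar + 1) := fun γ hγ =>
      (hstd γ x).trans (pow_le_pow_of_le_one hθ0 hθ1 (mem_filter.1 hγ).2)
    refine (sum_le_sum h2).trans ?_
    rw [sum_const, nsmul_eq_mul]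
    exact mul_le_mul_of_nonneg_right (by exact_mod_cast card_filter_le _ _) (pow_nonneg hθ0 _)
  refine (sum_le_sum h1).trans ?_
  rw [sum_const, nsmul_eq_mul]
  calc (((W'.filter fun x => ({x} : Finset ι) = X).card : ℕ) : ℝ) * (Fintype.card D * θ ^ (nbar + 1))
      ≤ 1 * (Fintype.card D * θ ^ (nbar + 1)) :=
        mul_le_mul_of_nonneg_right (by exact_mod_cast card_filter_singleton_le_one W' X) hnn
    _ = Fintype.card D * θ ^ (nbar + 1) := one_mul _

omit [DecidableEq P] in
/-- source (ii) vanishes unless `X` is a single cube. [cite: BalabanImbrieJaffe1988, p.310 (Sect. 5.14)] -/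
theorem highPart_eq_zero_of_card_ne_one (W' X : Finset ι) (hX : X.card ≠ 1) :
    ∑ x ∈ W'.filter (fun x => ({x} : Finset ι) = X), ∑ γ ∈ univ.filter (fun γ => nbar < ord γ), std m spec T Cstd γ x = 0 := by
  rw [filter_eq_empty_iff.2 fun x _ (h : ({x} : Finset ι) = X) => hX (h ▸ card_singleton x), sum_empty]

omit [DecidableEq P] in
/-- **Source (iii)**: the re-localization terms (*"we extend the localizations of vertices in all diagrams back to Λ̄₈. This produces more boundary
terms"*) anchored at `X = {x}`, `x ∈ Λ̄₈ ∖ Λ₁₂`: by (T) `|reloc part(X)| ≤ |D|·θ`. [cite: BalabanImbrieJaffe1988, p.311 (Sect. 5.14)] -/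
theorem abs_relocPart_le {θ : ℝ} (hθ0 : 0 ≤ θ) (hθ1 : θ ≤ 1) (hord : ∀ γ, 1 ≤ ord γ)
    (hstd : ∀ γ x, |std m spec T Cstd γ x| ≤ θ ^ ord γ) (A W' X : Finset ι) :
    |∑ x ∈ (A \ W').filter (fun x => ({x} : Finset ι) = X), ∑ γ ∈ univ.filter (fun γ => ord γ ≤ nbar), std m spec T Cstd γ x|
      ≤ Fintype.card D * θ := by
  refine (abs_sum_le_sum_abs _ _).trans ?_
  have hnn : 0 ≤ Fintype.card D * θ := by positivity
  have h1 : ∀ x ∈ (A \ W').filter (fun x => ({x} : Finset ι) = X),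
      |∑ γ ∈ univ.filter (fun γ => ord γ ≤ nbar), std m spec T Cstd γ x| ≤ Fintype.card D * θ := by
    intro x _
    refine (abs_sum_le_sum_abs _ _).trans ?_
    have h2 : ∀ γ ∈ univ.filter (fun γ => ord γ ≤ nbar), |std m spec T Cstd γ x| ≤ θ := fun γ _ =>
      (hstd γ x).trans ((pow_le_pow_of_le_one hθ0 hθ1 (hord γ)).trans_eq (pow_one θ))
    refine (sum_le_sum h2).trans ?_
    rw [sum_const, nsmul_eq_mul]
    exact mul_le_mul_of_nonneg_right (by exact_mod_cast card_filter_le _ _) hθ0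
  refine (sum_le_sum h1).trans ?_
  rw [sum_const, nsmul_eq_mul]
  calc ((((A \ W').filter fun x => ({x} : Finset ι) = X).card : ℕ) : ℝ) * (Fintype.card D * θ)
      ≤ 1 * (Fintype.card D * θ) := mul_le_mul_of_nonneg_right (by exact_mod_cast card_filter_singleton_le_one (A \ W') X) hnn
    _ = Fintype.card D * θ := one_mul _

omit [DecidableEq P] in
/-- source (iii) vanishes unless `X` is a single cube. [cite: BalabanImbrieJaffe1988, p.311 (Sect. 5.14)] -/
theorem relocPart_eq_zero_of_card_ne_one (A W' X : Finset ι) (hX : X.card ≠ 1) :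
    ∑ x ∈ (A \ W').filter (fun x => ({x} : Finset ι) = X), ∑ γ ∈ univ.filter (fun γ => ord γ ≤ nbar), std m spec T Cstd γ x = 0 := by
  rw [filter_eq_empty_iff.2 fun x _ (h : ({x} : Finset ι) = X) => hX (h ▸ card_singleton x), sum_empty]

omit [DecidableEq P] in
/-- **Why source (iii) is a boundary source**: at a far `X` (`far X → X ⊆ Λ₁₂ = W′`) no re-localization term is anchored, its cube lying in
`Λ̄₈ ∖ Λ₁₂`. [cite: BalabanImbrieJaffe1988, p.311 (Sect. 5.14)] -/
theorem relocPart_eq_zero_of_far {W' : Finset ι} {far : Finset ι → Prop} (hfarW : ∀ X, far X → X ⊆ W') (A : Finset ι) {X : Finset ι}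
    (hX : far X) :
    ∑ x ∈ (A \ W').filter (fun x => ({x} : Finset ι) = X), ∑ γ ∈ univ.filter (fun γ => ord γ ≤ nbar), std m spec T Cstd γ x = 0 := by
  rw [filter_eq_empty_iff.2 fun x hx (h : ({x} : Finset ι) = X) => (mem_sdiff.1 hx).2 (hfarW X hX (h ▸ mem_singleton_self x)),
    sum_empty]

end

end Literature.MathematicalPhysics.QuantumFieldTheory.BalabanImbrieJaffe1984to88.BIJ88Extraction311Bound
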